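import Mathlib.Analysis.Convex.Integral
import Mathlib.Analysis.Convex.SpecificFunctions.Basic
import Mathlib.Analysis.SpecialFunctions.Pow.Continuity
import Mathlib.Analysis.SpecialFunctions.Pow.Real
import Mathlib.Analysis.Complex.ExponentialBounds
import Mathlib.MeasureTheory.Integral.DominatedConvergence
import Mathlib.MeasureTheory.Integral.Average
import Literature.Analysis.Fourier.FractalUncertaintyPrinciple
import HarnessLib

/-!
# Bourgain–Dyatlov 2018, §3.2: the interpolation step of Lemma 3.2 (from the sub-mean-value inequality)

Analysis/Fourier proof file; companion to `FractalUncertaintyPrinciple` (the named fact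
`Literature.Analysis.Fourier.bourgainDyatlov2018_thm4`, J. Bourgain–S. Dyatlov, *Spectral gaps
without the pressure condition*, Ann. of Math. 187 (2018), Theorem 4). In the tree, Theorem 4 is
reduced (`FractalUncertaintyReduction.lean`) to the unique-continuation proposition of BD18 §3.3,
whose inputs are Lemma 3.1 (`FractalUncertaintyAdaptedWeight.lean`, from Lemma 2.11, itself from
the Beurling–Malliavin theorem, `FractalUncertaintyQuantitativeBM.lean`) and **Lemma 3.2**, "a
bound on functions with compact Fourier support", proved in BD18 §3.2 from the harmonic-measure
facts of §2.4 (Lemma 2.12: `log|F(t)| ≤ ∫ log|F| dμ_t`; Lemmas 2.13–2.15: density and mass bounds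
for the harmonic measure `μ_t` of a slit strip). Harmonic measure is not available in Mathlib;
this file begins the sorry-free deduction "§2.4 ⟹ Lemma 3.2" by proving its analytic core,
the per-point interpolation (2.10) ⟹ (3.15), abstractly in the three boundary pieces (the slit
`I₀` and the two lines `∂±Σ`) of `μ_t`:

* `rpow_neg_self_le` — `λ^{-λ} ≤ e^{1/e}`; `exp_five_mul_exp_neg_one_le_ten` — `e^{5/e} ≤ 10`;
* `integral_log_le_mass_mul_log` — Jensen for `log` against a finite measure
  (`∫ log u dν ≤ ν(univ) log(ν(univ)⁻¹ ∫ u dν)`), the convexity step of the printed proof;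
  `mass_mul_log_add_le` — the two-point log-sum inequality merging the two lines;
* `interpolation_exponent_replace` — "since `κ ≤ κ_I < 1` and `λ^{-λ} ≤ exp(1/e)`":
  `κ_I^{-4κ_I} a^{4κ_I} (1-κ_I)^{-(1-κ_I)} b^{1-κ_I} ≤ 10 a^{4κ} (a⁴+b)^{1-κ}`;
* `interpolation_of_log_subMeanValue` — **(2.10) ⟹ (3.15)**: if finite measures `ν₀, ν₁, ν₂`
  have total mass `1`, `0 < κ ≤ ν₀(univ)`, and bounded `h, H₁, H₂ ≥ 0`, `X ≥ 0` satisfy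
  `log(X+ε) ≤ ∫log(h²+ε)dν₀ + ∫log(H₁+ε)dν₁ + ∫log(H₂+ε)dν₂` for `0 < ε ≤ 1` (the sub-mean-value
  inequality for the subharmonic functions `log(|F|²+ε)`; the regularisation avoids `log 0`),
  then `X ≤ 10 (∫h^{1/2}dν₀)^{4κ} ((∫h^{1/2}dν₀)⁴ + ∫H₁dν₁ + ∫H₂dν₂)^{1-κ}` (Jensen twice,
  exponent replacement, `ε → 0` by dominated convergence).

Deliberately NOT here (yet, same file, in progress by this seat): the slit-strip bookkeeping of
Lemma 3.2 (Hölder with the `L^{4/3}` density bound of Lemma 2.13, the line bound of Lemma 2.14,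
`κ_I ≥ (c₀/8)e^{-2/r}` of Lemma 2.15, integration in `t`, the line Plancherel identity
`∫|F(x±ir)|²dx = ‖e^{∓2πrξ} f̂‖²`), with the §2.4 facts entering as one explicit hypothesis.
-/

namespace Literature.Analysis.Fourier

open _root_.MeasureTheory Set Filter
open scoped ENNReal NNReal Topology

/-- `λ^{-λ} ≤ e^{1/e}` for `λ ∈ [0, 1]` (BD18, proof of Lemma 3.2: "`λ^{-λ} ≤ exp(1/e)` for all
`λ > 0`"; at `λ = 0` Lean's `0^0 = 1`). [cite: BourgainDyatlov2018, Lemma 3.2 (proof)] -/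
theorem rpow_neg_self_le {m : ℝ} (hm0 : 0 ≤ m) : m ^ (-m) ≤ Real.exp (Real.exp (-1)) := by
  rcases hm0.eq_or_lt with rfl | hm
  · simp [Real.exp_nonneg]
  · -- `-m log m ≤ 1/e` from `log y ≤ y - 1` at `y = (e m)⁻¹`
    rw [Real.rpow_def_of_pos hm, Real.exp_le_exp]
    have hy : 0 < (Real.exp 1 * m)⁻¹ := by positivity
    have h := Real.log_le_sub_one_of_pos hy
    rw [Real.log_inv, Real.log_mul (Real.exp_pos 1).ne' hm.ne', Real.log_exp] at h
    have hm' : Real.log m * -m = m * (-(1 + Real.log m) ) + m := by ring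
    rw [hm']
    have h2 : -(1 + Real.log m) ≤ (Real.exp 1 * m)⁻¹ - 1 := by linarith
    have h3 : m * (-(1 + Real.log m)) ≤ m * ((Real.exp 1 * m)⁻¹ - 1) :=
      mul_le_mul_of_nonneg_left h2 hm.le
    have h4 : m * ((Real.exp 1 * m)⁻¹ - 1) + m = (Real.exp 1)⁻¹ := by field_simp; ring
    rw [Real.exp_neg]
    linarith

/-- `e^{5/e} ≤ 10` (the numerical constant of BD18 (3.15)). [cite: BourgainDyatlov2018, (3.15)] -/
theorem exp_five_mul_exp_neg_one_le_ten : Real.exp (5 * Real.exp (-1)) ≤ 10 := by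
  have he := Real.exp_one_gt_d9
  have he' := Real.exp_one_lt_d9
  have h1 : 5 * Real.exp (-1) ≤ 2 := by
    rw [Real.exp_neg]
    rw [← div_eq_mul_inv, div_le_iff₀ (Real.exp_pos 1)]
    linarith
  calc Real.exp (5 * Real.exp (-1)) ≤ Real.exp 2 := Real.exp_le_exp.2 h1
    _ = Real.exp 1 * Real.exp 1 := by rw [← Real.exp_add]; norm_num
    _ ≤ 10 := by nlinarith [Real.exp_pos 1]

/-- **Jensen for the logarithm against a finite measure** (the convexity step of BD18, proof of
Lemma 3.2): `∫ log u dν ≤ ν(univ) · log(ν(univ)⁻¹ ∫ u dν)` for a finite measure `ν` and a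
measurable `u` with `ε ≤ u ≤ M`, `ε > 0` (both sides vanish for `ν = 0`).
[cite: BourgainDyatlov2018, Lemma 3.2 (proof)] -/
theorem integral_log_le_mass_mul_log {α : Type*} [MeasurableSpace α] (ν : Measure α)
    [IsFiniteMeasure ν] {u : α → ℝ} (hu : AEStronglyMeasurable u ν) {ε M : ℝ} (hε : 0 < ε)
    (hlow : ∀ x, ε ≤ u x) (hup : ∀ x, u x ≤ M) :
    ∫ x, Real.log (u x) ∂ν ≤ ν.real univ * Real.log ((ν.real univ)⁻¹ * ∫ x, u x ∂ν) := by
  by_cases hν : ν = 0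
  · subst hν; simp
  haveI : NeZero ν := ⟨hν⟩
  have hupos : ∀ x, 0 < u x := fun x => hε.trans_le (hlow x)
  have hui : Integrable u ν := by
    refine Integrable.mono' (integrable_const (max |ε| |M|)) hu (Eventually.of_forall fun x => ?_)
    rw [Real.norm_eq_abs, abs_of_pos (hupos x)]
    exact (hup x).trans ((le_abs_self M).trans (le_max_right _ _))
  have hlogm : AEStronglyMeasurable (fun x => Real.log (u x)) ν :=
    (Real.measurable_log.comp_aemeasurable hu.aemeasurable).aestronglyMeasurable
  have hlogi : Integrable (fun x => Real.log (u x)) ν := by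
    refine Integrable.mono' (integrable_const (max |Real.log ε| |Real.log M|)) hlogm
      (Eventually.of_forall fun x => ?_)
    rw [Real.norm_eq_abs, abs_le]
    have h1 : Real.log ε ≤ Real.log (u x) := Real.log_le_log hε (hlow x)
    have h2 : Real.log (u x) ≤ Real.log M := Real.log_le_log (hupos x) (hup x)
    constructor
    · have := neg_abs_le (Real.log ε); have := le_max_left |Real.log ε| |Real.log M|; linarith
    · exact h2.trans ((le_abs_self _).trans (le_max_right _ _))
  have hJ := ConcaveOn.le_map_average (μ := ν) (f := u) (g := Real.log) (s := Ici ε)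
    (strictConcaveOn_log_Ioi.concaveOn.subset (fun x hx => hε.trans_le hx) (convex_Ici ε))
    (Real.continuousOn_log.mono fun x hx => ne_of_gt (hε.trans_le hx)) isClosed_Ici
    (Eventually.of_forall fun x => hlow x) hui hlogi
  rw [average_eq, average_eq, smul_eq_mul, smul_eq_mul] at hJ
  have hm : 0 < ν.real univ := measureReal_univ_pos
  calc ∫ x, Real.log (u x) ∂ν = ν.real univ * ((ν.real univ)⁻¹ * ∫ x, Real.log (u x) ∂ν) := by
        field_simp
    _ ≤ ν.real univ * Real.log ((ν.real univ)⁻¹ * ∫ x, u x ∂ν) :=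
        mul_le_mul_of_nonneg_left hJ hm.le

/-- The two-point log-sum inequality used to merge the two lines of the strip boundary (BD18,
proof of Lemma 3.2: the measure `(1-κ_I)⁻¹ μ_t|_{∂₋Σ ⊔ ∂₊Σ}` is a probability measure):
`m₁ log(b₁/m₁) + m₂ log(b₂/m₂) ≤ (m₁+m₂) log((b₁+b₂)/(m₁+m₂))`, with the terms read as `0` when
`mᵢ = 0`. [cite: BourgainDyatlov2018, Lemma 3.2 (proof)] -/
theorem mass_mul_log_add_le {m₁ m₂ b₁ b₂ : ℝ} (hm₁ : 0 ≤ m₁) (hm₂ : 0 ≤ m₂) (hb₁ : 0 ≤ b₁)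
    (hb₂ : 0 ≤ b₂) (hpos₁ : 0 < m₁ → 0 < b₁) (hpos₂ : 0 < m₂ → 0 < b₂) :
    m₁ * Real.log (m₁⁻¹ * b₁) + m₂ * Real.log (m₂⁻¹ * b₂) ≤
      (m₁ + m₂) * Real.log ((m₁ + m₂)⁻¹ * (b₁ + b₂)) := by
  rcases hm₁.eq_or_lt with rfl | h₁
  · simp only [zero_mul, zero_add]
    rcases hm₂.eq_or_lt with rfl | h₂
    · simp
    · refine mul_le_mul_of_nonneg_left (Real.log_le_log (by have := hpos₂ h₂; positivity) ?_) h₂.le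
      exact mul_le_mul_of_nonneg_left (by linarith) (by positivity)
  rcases hm₂.eq_or_lt with rfl | h₂
  · simp only [zero_mul, add_zero]
    refine mul_le_mul_of_nonneg_left (Real.log_le_log (by have := hpos₁ h₁; positivity) ?_) h₁.le
    exact mul_le_mul_of_nonneg_left (by linarith) (by positivity)
  have hb₁' := hpos₁ h₁
  have hb₂' := hpos₂ h₂
  have hm : 0 < m₁ + m₂ := by linarith
  -- concavity of `log` with weights `mᵢ/(m₁+m₂)` at the points `bᵢ/mᵢ`
  have hc := strictConcaveOn_log_Ioi.concaveOn.2 (show m₁⁻¹ * b₁ ∈ Ioi (0:ℝ) from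
      Set.mem_Ioi.2 (by positivity))
    (show m₂⁻¹ * b₂ ∈ Ioi (0:ℝ) from Set.mem_Ioi.2 (by positivity)) (show 0 ≤ m₁ / (m₁ + m₂) by positivity)
    (show 0 ≤ m₂ / (m₁ + m₂) by positivity) (by field_simp)
  simp only [smul_eq_mul] at hc
  have hpt : m₁ / (m₁ + m₂) * (m₁⁻¹ * b₁) + m₂ / (m₁ + m₂) * (m₂⁻¹ * b₂) =
      (m₁ + m₂)⁻¹ * (b₁ + b₂) := by field_simp
  rw [hpt] at hc
  have := mul_le_mul_of_nonneg_left hc hm.le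
  have e : (m₁ + m₂) * (m₁ / (m₁ + m₂) * Real.log (m₁⁻¹ * b₁) + m₂ / (m₁ + m₂) * Real.log (m₂⁻¹ * b₂))
      = m₁ * Real.log (m₁⁻¹ * b₁) + m₂ * Real.log (m₂⁻¹ * b₂) := by field_simp
  linarith

/-- **Replacing the exponent `κ_I` by `κ ≤ κ_I`** (BD18 (3.15): "since `κ ≤ κ_I < 1` and
`λ^{-λ} ≤ exp(1/e)`"): for `0 < κ ≤ m ≤ 1` and `a, b ≥ 0`,
`m^{-4m} a^{4m} (1-m)^{-(1-m)} b^{1-m} ≤ 10 a^{4κ} (a⁴ + b)^{1-κ}`.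
[cite: BourgainDyatlov2018, (3.15)] -/
theorem interpolation_exponent_replace {κ m a b : ℝ} (hκ0 : 0 < κ) (hκm : κ ≤ m) (hm1 : m ≤ 1)
    (ha : 0 ≤ a) (hb : 0 ≤ b) :
    m ^ (-(4 * m)) * a ^ (4 * m) * ((1 - m) ^ (-(1 - m)) * b ^ (1 - m)) ≤
      10 * (a ^ (4 * κ) * (a ^ 4 + b) ^ (1 - κ)) := by
  have hm0 : 0 < m := hκ0.trans_le hκm
  -- the numerical factor
  have h1 : m ^ (-(4 * m)) ≤ Real.exp (Real.exp (-1)) ^ 4 := by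
    rw [show (-(4 * m)) = (-m) * 4 by ring, Real.rpow_mul hm0.le, show ((4 : ℝ)) = ((4 : ℕ) : ℝ) by norm_num,
      Real.rpow_natCast]
    exact pow_le_pow_left₀ (Real.rpow_nonneg hm0.le _) (rpow_neg_self_le hm0.le) 4
  have h2 : (1 - m) ^ (-(1 - m)) ≤ Real.exp (Real.exp (-1)) := rpow_neg_self_le (by linarith)
  have hnum : Real.exp (Real.exp (-1)) ^ 4 * Real.exp (Real.exp (-1)) ≤ 10 := by
    have : Real.exp (Real.exp (-1)) ^ 4 * Real.exp (Real.exp (-1)) = Real.exp (5 * Real.exp (-1)) := by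
      rw [← Real.exp_nat_mul, ← Real.exp_add]; congr 1; push_cast; ring
    rw [this]; exact exp_five_mul_exp_neg_one_le_ten
  -- the monotone factors: `a^{4m} b^{1-m} ≤ a^{4κ} (a⁴+b)^{1-κ}`
  set S : ℝ := a ^ 4 + b with hS
  have hA : 0 ≤ a ^ 4 := by positivity
  have hAS : a ^ 4 ≤ S := by rw [hS]; linarith
  have hbS : b ≤ S := by rw [hS]; linarith
  have hS0 : 0 ≤ S := hA.trans hAS
  have hmono : a ^ (4 * m) * b ^ (1 - m) ≤ a ^ (4 * κ) * S ^ (1 - κ) := by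
    have e1 : a ^ (4 * m) = a ^ (4 * κ) * (a ^ 4) ^ (m - κ) := by
      rw [← Real.rpow_natCast a 4, ← Real.rpow_mul ha, ← Real.rpow_add_of_nonneg ha (by positivity)
        (by push_cast; nlinarith)]
      congr 1; push_cast; ring
    rw [e1, mul_assoc]
    refine mul_le_mul_of_nonneg_left ?_ (Real.rpow_nonneg ha _)
    calc (a ^ 4) ^ (m - κ) * b ^ (1 - m) ≤ S ^ (m - κ) * S ^ (1 - m) :=
          mul_le_mul (Real.rpow_le_rpow hA hAS (by linarith)) (Real.rpow_le_rpow hb hbS (by linarith))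
            (Real.rpow_nonneg hb _) (Real.rpow_nonneg hS0 _)
      _ = S ^ (1 - κ) := by
          rw [← Real.rpow_add_of_nonneg hS0 (by linarith) (by linarith)]; congr 1; ring
  calc m ^ (-(4 * m)) * a ^ (4 * m) * ((1 - m) ^ (-(1 - m)) * b ^ (1 - m))
      = (m ^ (-(4 * m)) * (1 - m) ^ (-(1 - m))) * (a ^ (4 * m) * b ^ (1 - m)) := by ring
    _ ≤ (Real.exp (Real.exp (-1)) ^ 4 * Real.exp (Real.exp (-1))) * (a ^ (4 * κ) * S ^ (1 - κ)) :=
        mul_le_mul (mul_le_mul h1 h2 (Real.rpow_nonneg (by linarith) _) (by positivity)) hmono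
          (by positivity) (by positivity)
    _ ≤ 10 * (a ^ (4 * κ) * S ^ (1 - κ)) := mul_le_mul_of_nonneg_right hnum (by positivity)


/-- **The per-point interpolation of BD18, proof of Lemma 3.2** ((2.10) ⟹ (3.15)), abstractly:
let `ν₀, ν₁, ν₂` be finite measures of total mass `1` (the harmonic measure of the slit strip split
into the slit `I₀` and the two lines `∂₊Σ, ∂₋Σ`), `0 < κ ≤ ν₀(univ)`, and let bounded measurable
`h ≥ 0` (`= |f|` on `I₀`), `H₁, H₂ ≥ 0` (`= |F|²` on the lines) and `X ≥ 0` (`= |F(t)|²`) satisfy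
the (regularised) sub-mean-value inequality
`log(X+ε) ≤ ∫ log(h²+ε) dν₀ + ∫ log(H₁+ε) dν₁ + ∫ log(H₂+ε) dν₂` for all `0 < ε ≤ 1`. Then
`X ≤ 10 (∫ h^{1/2} dν₀)^{4κ} ((∫ h^{1/2} dν₀)⁴ + ∫ H₁ dν₁ + ∫ H₂ dν₂)^{1-κ}` — Jensen for the
probability measures `κ_I⁻¹ν₀`, `(1-κ_I)⁻¹(ν₁+ν₂)` (`κ_I = ν₀(univ)`), then `κ_I ↦ κ` by
`λ^{-λ} ≤ e^{1/e}`, then `ε → 0`. [cite: BourgainDyatlov2018, Lemma 3.2 (proof), (3.15)] -/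
theorem interpolation_of_log_subMeanValue {α β γ : Type*} [MeasurableSpace α]
    [MeasurableSpace β] [MeasurableSpace γ] (ν₀ : Measure α) (ν₁ : Measure β) (ν₂ : Measure γ)
    [IsFiniteMeasure ν₀] [IsFiniteMeasure ν₁] [IsFiniteMeasure ν₂]
    (hmass : ν₀.real univ + ν₁.real univ + ν₂.real univ = 1)
    {κ : ℝ} (hκ0 : 0 < κ) (hκ : κ ≤ ν₀.real univ)
    {h : α → ℝ} {H₁ : β → ℝ} {H₂ : γ → ℝ} (hh0 : ∀ x, 0 ≤ h x) (hH₁0 : ∀ y, 0 ≤ H₁ y)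
    (hH₂0 : ∀ y, 0 ≤ H₂ y) {M : ℝ} (hhM : ∀ x, h x ≤ M) (hH₁M : ∀ y, H₁ y ≤ M)
    (hH₂M : ∀ y, H₂ y ≤ M) (hhm : AEStronglyMeasurable h ν₀) (hH₁m : AEStronglyMeasurable H₁ ν₁)
    (hH₂m : AEStronglyMeasurable H₂ ν₂) {X : ℝ} (hX : 0 ≤ X)
    (hsub : ∀ ε : ℝ, 0 < ε → ε ≤ 1 → Real.log (X + ε) ≤
      ∫ x, Real.log (h x ^ 2 + ε) ∂ν₀ + (∫ y, Real.log (H₁ y + ε) ∂ν₁ + ∫ y, Real.log (H₂ y + ε) ∂ν₂)) :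
    X ≤ 10 * ((∫ x, h x ^ (1 / 2 : ℝ) ∂ν₀) ^ (4 * κ) *
      ((∫ x, h x ^ (1 / 2 : ℝ) ∂ν₀) ^ 4 + (∫ y, H₁ y ∂ν₁ + ∫ y, H₂ y ∂ν₂)) ^ (1 - κ)) := by
  -- masses
  set m : ℝ := ν₀.real univ with hm
  set m₁ : ℝ := ν₁.real univ with hm₁
  set m₂ : ℝ := ν₂.real univ with hm₂
  have hm0 : 0 < m := hκ0.trans_le hκ
  have hm₁0 : 0 ≤ m₁ := measureReal_nonneg
  have hm₂0 : 0 ≤ m₂ := measureReal_nonneg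
  have hm1 : m ≤ 1 := by linarith
  have hM0 : 0 ≤ M := by
    rcases isEmpty_or_nonempty α with hα | ⟨⟨x⟩⟩
    · -- `ν₀ = 0` contradicts `m > 0`
      have : ν₀ = 0 := Measure.eq_zero_of_isEmpty ν₀
      simp [hm, this] at hm0
    · exact (hh0 x).trans (hhM x)
  -- the regularised quantities
  set a : ℝ → ℝ := fun ε => ∫ x, (h x ^ 2 + ε) ^ (1 / 4 : ℝ) ∂ν₀ with ha
  set b : ℝ → ℝ := fun ε => ∫ y, (H₁ y + ε) ∂ν₁ + ∫ y, (H₂ y + ε) ∂ν₂ with hb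
  have ha0 : ∀ ε, 0 ≤ ε → 0 ≤ a ε := fun ε hε0 => integral_nonneg fun x =>
    show (0:ℝ) ≤ _ from Real.rpow_nonneg (by nlinarith [hh0 x]) _
  -- Step 1: the bound for fixed `0 < ε ≤ 1`
  have hstep : ∀ ε : ℝ, 0 < ε → ε ≤ 1 →
      X ≤ 10 * (a ε ^ (4 * κ) * (a ε ^ 4 + b ε) ^ (1 - κ)) := by
    intro ε hε hε1
    -- Jensen on `ν₀` with `u₀ = (h²+ε)^{1/4}`
    have hu₀m : AEStronglyMeasurable (fun x => (h x ^ 2 + ε) ^ (1 / 4 : ℝ)) ν₀ :=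
      ((hhm.aemeasurable.pow_const 2).add_const ε |>.pow_const _).aestronglyMeasurable
    have hu₀low : ∀ x, ε ^ (1 / 4 : ℝ) ≤ (h x ^ 2 + ε) ^ (1 / 4 : ℝ) := fun x =>
      Real.rpow_le_rpow hε.le (by nlinarith [hh0 x]) (by norm_num)
    have hu₀up : ∀ x, (h x ^ 2 + ε) ^ (1 / 4 : ℝ) ≤ (M ^ 2 + 1) ^ (1 / 4 : ℝ) := fun x =>
      Real.rpow_le_rpow (by nlinarith [hh0 x]) (by nlinarith [hh0 x, hhM x]) (by norm_num)
    have hJ₀ := integral_log_le_mass_mul_log ν₀ hu₀m (Real.rpow_pos_of_pos hε _) hu₀low hu₀up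
    have hlog₀ : ∫ x, Real.log (h x ^ 2 + ε) ∂ν₀ = 4 * ∫ x, Real.log ((h x ^ 2 + ε) ^ (1 / 4 : ℝ)) ∂ν₀ := by
      rw [← integral_const_mul]
      refine integral_congr_ae (Eventually.of_forall fun x => ?_)
      show Real.log (h x ^ 2 + ε) = 4 * Real.log ((h x ^ 2 + ε) ^ (1 / 4 : ℝ))
      rw [Real.log_rpow (by nlinarith [hh0 x] : (0:ℝ) < h x ^ 2 + ε)]
      ring
    -- Jensen on `ν₁`, `ν₂`
    have hJ₁ := integral_log_le_mass_mul_log ν₁ (hH₁m.aemeasurable.add_const ε).aestronglyMeasurable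
      hε (fun y => by linarith [hH₁0 y]) (fun y => show H₁ y + ε ≤ M + 1 by linarith [hH₁M y])
    have hJ₂ := integral_log_le_mass_mul_log ν₂ (hH₂m.aemeasurable.add_const ε).aestronglyMeasurable
      hε (fun y => by linarith [hH₂0 y]) (fun y => show H₂ y + ε ≤ M + 1 by linarith [hH₂M y])
    have hb₁0 : 0 ≤ ∫ y, (H₁ y + ε) ∂ν₁ := integral_nonneg fun y => by
      show (0:ℝ) ≤ _; linarith [hH₁0 y]
    have hb₂0 : 0 ≤ ∫ y, (H₂ y + ε) ∂ν₂ := integral_nonneg fun y => by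
      show (0:ℝ) ≤ _; linarith [hH₂0 y]
    have hbpos₁ : 0 < m₁ → 0 < ∫ y, (H₁ y + ε) ∂ν₁ := fun hpos => by
      have : m₁ * ε ≤ ∫ y, (H₁ y + ε) ∂ν₁ := by
        have h1 : ∫ _y, ε ∂ν₁ ≤ ∫ y, (H₁ y + ε) ∂ν₁ := by
          refine integral_mono (integrable_const _) ?_ fun y => by linarith [hH₁0 y]
          exact ((integrable_const (M + 1)).mono' (hH₁m.aemeasurable.add_const ε).aestronglyMeasurable
            (Eventually.of_forall fun y => by
              rw [Real.norm_eq_abs, abs_of_nonneg (by linarith [hH₁0 y])]; linarith [hH₁M y]))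
        rw [integral_const, smul_eq_mul] at h1
        linarith
      nlinarith
    have hbpos₂ : 0 < m₂ → 0 < ∫ y, (H₂ y + ε) ∂ν₂ := fun hpos => by
      have : m₂ * ε ≤ ∫ y, (H₂ y + ε) ∂ν₂ := by
        have h1 : ∫ _y, ε ∂ν₂ ≤ ∫ y, (H₂ y + ε) ∂ν₂ := by
          refine integral_mono (integrable_const _) ?_ fun y => by linarith [hH₂0 y]
          exact ((integrable_const (M + 1)).mono' (hH₂m.aemeasurable.add_const ε).aestronglyMeasurable
            (Eventually.of_forall fun y => by
              rw [Real.norm_eq_abs, abs_of_nonneg (by linarith [hH₂0 y])]; linarith [hH₂M y]))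
        rw [integral_const, smul_eq_mul] at h1
        linarith
      nlinarith
    have hJ₁₂ := mass_mul_log_add_le hm₁0 hm₂0 hb₁0 hb₂0 hbpos₁ hbpos₂
    -- combine: `log (X+ε) ≤ 4 m log (a/m) + (m₁+m₂) log (b/(m₁+m₂))`
    have hcomb : Real.log (X + ε) ≤ 4 * (m * Real.log (m⁻¹ * a ε)) +
        (m₁ + m₂) * Real.log ((m₁ + m₂)⁻¹ * b ε) := by
      have h := hsub ε hε hε1
      rw [hlog₀] at h
      have : b ε = ∫ y, (H₁ y + ε) ∂ν₁ + ∫ y, (H₂ y + ε) ∂ν₂ := rfl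
      rw [this]
      nlinarith [hJ₀, hJ₁, hJ₂, hJ₁₂]
    -- exponentiate
    have haε : 0 < a ε := by
      have : m * ε ^ (1 / 4 : ℝ) ≤ a ε := by
        have h1 : ∫ _x, ε ^ (1 / 4 : ℝ) ∂ν₀ ≤ a ε :=
          integral_mono (integrable_const _) ((integrable_const ((M ^ 2 + 1) ^ (1 / 4 : ℝ))).mono'
            hu₀m (Eventually.of_forall fun x => by
              rw [Real.norm_of_nonneg (Real.rpow_nonneg (by nlinarith [hh0 x]) _)]; exact hu₀up x))
            hu₀low
        rw [integral_const, smul_eq_mul] at h1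
        exact h1
      have : 0 < m * ε ^ (1 / 4 : ℝ) := mul_pos hm0 (Real.rpow_pos_of_pos hε _)
      linarith
    have hm12 : m₁ + m₂ = 1 - m := by linarith
    have hexp : X + ε ≤ (m⁻¹ * a ε) ^ (4 * m) * ((m₁ + m₂)⁻¹ * b ε) ^ (m₁ + m₂) := by
      have hXε : 0 < X + ε := by linarith
      rw [← Real.exp_log hXε]
      refine (Real.exp_le_exp.2 hcomb).trans (le_of_eq ?_)
      rw [Real.exp_add, Real.rpow_def_of_pos (by positivity : 0 < m⁻¹ * a ε)]
      congr 1
      · congr 1; ring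
      · rcases (add_nonneg hm₁0 hm₂0).eq_or_lt with h0 | hpos
        · rw [← h0]; simp
        · have hbε : 0 < b ε := by
            rcases hm₁0.eq_or_lt with h1 | h1
            · have h2 : 0 < m₂ := by linarith
              have := hbpos₂ h2; simp only [hb]; linarith
            · have := hbpos₁ h1; simp only [hb]; linarith
          rw [Real.rpow_def_of_pos (by positivity : 0 < (m₁ + m₂)⁻¹ * b ε)]
          congr 1; ring
    -- rewrite and replace exponents
    have hb0 : 0 ≤ b ε := add_nonneg hb₁0 hb₂0
    have hrw : (m⁻¹ * a ε) ^ (4 * m) * ((m₁ + m₂)⁻¹ * b ε) ^ (m₁ + m₂) =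
        m ^ (-(4 * m)) * a ε ^ (4 * m) * ((1 - m) ^ (-(1 - m)) * b ε ^ (1 - m)) := by
      rw [hm12, Real.mul_rpow (by positivity) (ha0 ε hε.le), Real.mul_rpow (by
        rw [← hm12]; positivity) hb0, Real.inv_rpow hm0.le, Real.inv_rpow (by linarith),
        ← Real.rpow_neg hm0.le, ← Real.rpow_neg (by linarith)]
    calc X ≤ X + ε := by linarith
      _ ≤ _ := hexp
      _ = _ := hrw
      _ ≤ 10 * (a ε ^ (4 * κ) * (a ε ^ 4 + b ε) ^ (1 - κ)) :=
          interpolation_exponent_replace hκ0 hκ hm1 (ha0 ε hε.le) hb0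
  -- Step 2: `ε = 1/(n+1) → 0`
  set εs : ℕ → ℝ := fun n => 1 / ((n : ℝ) + 1) with hεs
  have hεpos : ∀ n, 0 < εs n := fun n => by positivity
  have hεle : ∀ n, εs n ≤ 1 := fun n => by
    rw [hεs]; rw [div_le_one (by positivity)]; linarith [n.cast_nonneg (α := ℝ)]
  have hεlim : Tendsto εs atTop (𝓝 0) := tendsto_one_div_add_atTop_nhds_zero_nat
  have ha_lim : Tendsto (fun n => a (εs n)) atTop (𝓝 (∫ x, h x ^ (1 / 2 : ℝ) ∂ν₀)) := by
    refine tendsto_integral_of_dominated_convergence (fun _ => (M ^ 2 + 1) ^ (1 / 4 : ℝ))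
      (fun n => ((hhm.aemeasurable.pow_const 2).add_const (εs n) |>.pow_const _).aestronglyMeasurable)
      (integrable_const _) (fun n => Eventually.of_forall fun x => ?_) (Eventually.of_forall fun x => ?_)
    · rw [Real.norm_of_nonneg (Real.rpow_nonneg (by nlinarith [hh0 x, hεpos n]) _)]
      exact Real.rpow_le_rpow (by nlinarith [hh0 x, hεpos n]) (by nlinarith [hh0 x, hhM x, hεle n]) (by norm_num)
    · have hcont : ContinuousAt (fun ε : ℝ => (h x ^ 2 + ε) ^ (1 / 4 : ℝ)) 0 :=
        ((continuous_const.add continuous_id).continuousAt).rpow_const (Or.inr (by norm_num))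
      have h1 := hcont.tendsto.comp hεlim
      have h2 : (h x ^ 2 + 0) ^ (1 / 4 : ℝ) = h x ^ (1 / 2 : ℝ) := by
        rw [add_zero, ← Real.rpow_natCast (h x) 2, ← Real.rpow_mul (hh0 x)]; norm_num
      rw [h2] at h1
      exact h1
  have hb_lim : Tendsto (fun n => b (εs n)) atTop (𝓝 (∫ y, H₁ y ∂ν₁ + ∫ y, H₂ y ∂ν₂)) := by
    have hH₁i : Integrable H₁ ν₁ := (integrable_const M).mono' hH₁m (Eventually.of_forall fun y => by
      rw [Real.norm_of_nonneg (hH₁0 y)]; exact hH₁M y)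
    have hH₂i : Integrable H₂ ν₂ := (integrable_const M).mono' hH₂m (Eventually.of_forall fun y => by
      rw [Real.norm_of_nonneg (hH₂0 y)]; exact hH₂M y)
    have hb_eq : ∀ n, b (εs n) = (∫ y, H₁ y ∂ν₁ + ∫ y, H₂ y ∂ν₂) + εs n * (m₁ + m₂) := by
      intro n
      simp only [hb]
      rw [integral_add hH₁i (integrable_const _), integral_add hH₂i (integrable_const _),
        integral_const, integral_const, smul_eq_mul, smul_eq_mul]
      ring
    simp_rw [hb_eq]
    have := (hεlim.mul_const (m₁ + m₂)).const_add (∫ y, H₁ y ∂ν₁ + ∫ y, H₂ y ∂ν₂)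
    simpa using this
  have hR_lim : Tendsto (fun n => 10 * (a (εs n) ^ (4 * κ) * (a (εs n) ^ 4 + b (εs n)) ^ (1 - κ)))
      atTop (𝓝 (10 * ((∫ x, h x ^ (1 / 2 : ℝ) ∂ν₀) ^ (4 * κ) *
        ((∫ x, h x ^ (1 / 2 : ℝ) ∂ν₀) ^ 4 + (∫ y, H₁ y ∂ν₁ + ∫ y, H₂ y ∂ν₂)) ^ (1 - κ)))) := by
    refine Tendsto.const_mul 10 (Tendsto.mul ?_ ?_)
    · exact ha_lim.rpow_const (Or.inr (by linarith))
    · exact ((ha_lim.pow 4).add hb_lim).rpow_const (Or.inr (by linarith))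
  exact ge_of_tendsto' hR_lim fun n => hstep (εs n) (hεpos n) (hεle n)

end Literature.Analysis.Fourier
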